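import Literature.MathematicalPhysics.QuantumManyBody.PeriodicBoseGasFracEnergy
import Literature.MathematicalPhysics.QuantumManyBody.PeriodicCondensateCoherence
import Literature.MathematicalPhysics.QuantumManyBody.PeriodicFeynmanKacCell
import Literature.MathematicalPhysics.QuantumManyBody.PeriodicBoseGasEq317Bdd
import Literature.MathematicalPhysics.QuantumManyBody.PeriodicBoseGasLemma33
import HarnessLib

/-!
# Route BECLaplacianL1, item `ModeCountingL1` — helper 1/3: Wiener–Khinchin on the cell

Support file for `Summit.AtomisticToContinuum.BoseEinsteinCondensation.Theses.BECLaplacianL1.ModeCountingL1`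
(stmt-AtomisticToContinuum-9012). The route's mode count rests on the identity
`∫_cell conj(e_p(r)) G_Ψ(r) dr = L³|2πp/L|² n_p(Ψ)` for the kinetic coherence
`G_Ψ(r) = ∑ᵢ ∑ₖ ∫_{cell^N} ∂_{i,k}Ψ(X + r eᵢ) conj ∂_{i,k}Ψ(X) dX` of a periodic trial state. This first
helper supplies the ONE-BODY step and a small toolkit:

* `integral_conj_cellWave_mul_autocorr` — **Wiener–Khinchin on the cell**: for a continuous
  `Lℤ³`-periodic `h : ℝ³ → ℂ`, `∫_cell conj(e_p(r)) (∫_cell h(x + r) conj h(x) dx) dr = L⁶ |ĉ_p(h)|²`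
  (Fubini on `cell × cell`, translation invariance of cell integrals of periodic functions
  `setIntegral_cell_comp_add_of_periodic`, `conj(e_p(r)) = e_p(x) conj(e_p(x + r))`);
* toolkit: `integral_conj_cellWave_mul` (`∫ conj(e_p) f = L³ ĉ_p(f)`), boundedness of continuous
  periodic one-body and `N`-body functions, and the slice chain rules `fderiv_slice_apply` /
  `fderiv_vecCons_apply` (`∂(y ↦ Ψ(y, Y))(x)·w = DΨ(x,Y)·(e₀ ⊗ w)`).

No new definitions (plane waves `cellWave`, coefficients `cellFourierCoeff` and the cell transport
are those of `PeriodicBoseGasFourier.lean`; `cellWave_add` is `PeriodicBoseGasLemma33`'s). Continued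
in `BECLaplacianL1ModeCountingL1Slices.lean` and `BECLaplacianL1ModeCountingL1IRBound.lean`.

## References

* [LSSY2005] E. H. Lieb, R. Seiringer, J. P. Solovej, J. Yngvason, *The Mathematics of the Bose Gas
  and its Condensation*, Birkhäuser 2005, §1.2 (1.17)–(1.19) (one-particle density matrix, mode
  occupations, `tr γ = N`).
* [KLS1988PRL] T. Kennedy, E. H. Lieb, B. S. Shastry, Phys. Rev. Lett. 61 (1988) 2582 (infrared
  bound ⇒ long-range order by mode counting in `d = 3`).
-/

noncomputable section

open MeasureTheory Filter Complex
open scoped ENNReal NNReal ComplexConjugate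

namespace Summit.AtomisticToContinuum.BoseEinsteinCondensation.Theorems

namespace LaplacianModeCounting

open Literature.MathematicalPhysics.QuantumManyBody.BoseGas

variable {N n : ℕ} {L : ℝ}

/-! ## §1 Small toolkit -/

/-- `conj(e_p(r)) = e_p(x) conj(e_p(x + r))`. [folklore] -/
theorem conj_cellWave_eq_mul_conj_add (L : ℝ) (p : Fin 3 → ℤ) (x r : Space) :
    conj (cellWave L p r) = cellWave L p x * conj (cellWave L p (x + r)) := by
  rw [cellWave_add, map_mul, ← mul_assoc, Complex.mul_conj', norm_cellWave]
  simp

/-- `∫_cell conj(e_p) f = L³ ĉ_p(f)`. [folklore] -/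
theorem integral_conj_cellWave_mul (hL : 0 < L) (f : Space → ℂ) (p : Fin 3 → ℤ) :
    ∫ x in cell L, conj (cellWave L p x) * f x = (L : ℂ) ^ 3 * cellFourierCoeff L f p := by
  rw [cellFourierCoeff_eq_integral hL, Complex.real_smul, ← mul_assoc]
  push_cast
  rw [mul_inv_cancel₀ (pow_ne_zero 3 (Complex.ofReal_ne_zero.2 hL.ne')), one_mul]

/-- A continuous `Lℤ³`-periodic one-body function is bounded. [folklore] -/
theorem exists_norm_le_of_periodic₁ (hL : 0 < L) {h : Space → ℂ} (hh : Continuous h)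
    (hper : ∀ (x : Space) (k : Fin 3), h (x + EuclideanSpace.single k L) = h x) :
    ∃ M : ℝ, ∀ x, ‖h x‖ ≤ M := by
  obtain ⟨C, hC⟩ := exists_bound_torusFun hL hh
  refine ⟨C, fun x => ?_⟩
  have h1 := torusFun_toUnitTorus hL hper x
  rw [torusFun] at h1
  rw [← h1]
  exact hC _

/-- A continuous `N`-body function periodic in every particle and axis is bounded (it factors through
the reduction `cellProj` to the fundamental cell, which is bounded). [folklore] -/
theorem exists_norm_le_of_periodic {E : Type*} [SeminormedAddCommGroup E] (hL : 0 < L)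
    {Φ : Config N → E} (hΦ : Continuous Φ)
    (hper : ∀ (X : Config N) (i : Fin N) (k : Fin 3),
      Φ (X + Pi.single i (EuclideanSpace.single k L)) = Φ X) :
    ∃ M : ℝ, ∀ X, ‖Φ X‖ ≤ M := by
  obtain ⟨C, hC⟩ := (isCompact_closedBall (0 : Config N) (2 * L)).exists_bound_of_continuousOn
    hΦ.continuousOn
  refine ⟨C, fun X => ?_⟩
  rw [← apply_cellProj_of_periodic hper X]
  refine hC _ (Metric.mem_closedBall.2 ?_)
  rw [dist_zero_right]
  exact norm_le_of_mem_cellN hL (cellProj_mem_cellN hL X)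

/-- **Chain rule for slices**: the derivative of `y ↦ Ψ(update X i y)` at `x` along `w` is the
partial derivative of `Ψ` at `update X i x` along `eᵢ ⊗ w`. [folklore] -/
theorem fderiv_slice_apply {Ψ : Config N → ℂ} (hΨ : Differentiable ℝ Ψ) (X : Config N) (i : Fin N)
    (x w : Space) :
    fderiv ℝ (fun y => Ψ (Function.update X i y)) x w =
      fderiv ℝ Ψ (Function.update X i x) (Pi.single i w) := by
  have h := hasFDerivAt_update (𝕜 := ℝ) X (i := i) x
  have harg : (ContinuousLinearMap.pi (Pi.single i (ContinuousLinearMap.id ℝ Space)) :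
      Space →L[ℝ] Config N) w = Pi.single i w := by
    funext j
    by_cases hj : j = i
    · subst hj; simp
    · simp [hj]
  rw [show (fun y => Ψ (Function.update X i y)) = Ψ ∘ Function.update X i from rfl,
    fderiv_comp x (hΨ _) h.differentiableAt, h.fderiv, ContinuousLinearMap.comp_apply, harg]

/-- Chain rule at the first particle: `∂(y ↦ Ψ(y, Y))(x)·w = DΨ(x, Y)·(e₀ ⊗ w)`. [folklore] -/
theorem fderiv_vecCons_apply {Ψ : Config (n + 1) → ℂ} (hΨ : Differentiable ℝ Ψ) (Y : Config n)
    (x w : Space) :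
    fderiv ℝ (fun y => Ψ (Matrix.vecCons y Y)) x w =
      fderiv ℝ Ψ (Matrix.vecCons x Y) (Pi.single 0 w) := by
  have hupd : ∀ y, Function.update (Matrix.vecCons (0 : Space) Y) 0 y = Matrix.vecCons y Y :=
    fun y => Fin.update_cons_zero (α := fun _ => Space) 0 Y y
  have h := fderiv_slice_apply hΨ (Matrix.vecCons 0 Y) 0 x w
  simp only [hupd] at h
  exact h


/-! ## §2 One-body Wiener–Khinchin on the cell -/

/-- **Wiener–Khinchin on the cell (one body).** For a continuous `Lℤ³`-periodic `h : ℝ³ → ℂ`, the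
`p`-th Fourier coefficient of its autocorrelation `A_h(r) = ∫_cell h(x + r) conj(h(x)) dx` is
`∫_cell conj(e_p(r)) A_h(r) dr = L⁶ |ĉ_p(h)|²` (Fubini on `cell × cell`, the substitution
`s = x + r` on the torus, `conj(e_p(r)) = e_p(x) conj(e_p(x + r))`). [folklore] -/
theorem integral_conj_cellWave_mul_autocorr (hL : 0 < L) {h : Space → ℂ} (hh : Continuous h)
    (hper : ∀ (x : Space) (k : Fin 3), h (x + EuclideanSpace.single k L) = h x) (p : Fin 3 → ℤ) :
    ∫ r in cell L, conj (cellWave L p r) * ∫ x in cell L, h (x + r) * conj (h x) =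
      (((L ^ 3) ^ 2 * ‖cellFourierCoeff L h p‖ ^ 2 : ℝ) : ℂ) := by
  obtain ⟨M, hM⟩ := exists_norm_le_of_periodic₁ hL hh hper
  have hM0 : 0 ≤ M := (norm_nonneg _).trans (hM 0)
  haveI : IsFiniteMeasure ((volume : Measure Space).restrict (cell L)) :=
    isFiniteMeasure_restrict.2 (by rw [volume_cell]; exact ENNReal.pow_ne_top ENNReal.ofReal_ne_top)
  have hwc : Continuous (cellWave L p) := (contDiff_cellWave L p).continuous
  -- joint integrability on `cell × cell`
  have hF : Integrable (Function.uncurry fun r x => conj (cellWave L p r) * (h (x + r) * conj (h x)))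
      ((volume.restrict (cell L)).prod (volume.restrict (cell L))) := by
    refine Integrable.of_bound ?_ (M * M) (Eventually.of_forall ?_)
    · refine Continuous.aestronglyMeasurable ?_
      exact (Complex.continuous_conj.comp (hwc.comp continuous_fst)).mul
        ((hh.comp (continuous_snd.add continuous_fst)).mul
          (Complex.continuous_conj.comp (hh.comp continuous_snd)))
    · rintro ⟨r, x⟩
      simp only [Function.uncurry_apply_pair, norm_mul, Complex.norm_conj, norm_cellWave, one_mul]
      exact mul_le_mul (hM _) (hM _) (norm_nonneg _) hM0
  -- the periodic integrand `conj(e_p) h`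
  have hH : ∀ (s : Space) (k : Fin 3), (fun s => conj (cellWave L p s) * h s) (s + EuclideanSpace.single k L) =
      (fun s => conj (cellWave L p s) * h s) s := by
    intro s k
    simp only [cellWave_periodic hL.ne', hper]
  -- the inner integral after the swap
  have hinner : ∀ x : Space, ∫ r in cell L, conj (cellWave L p r) * (h (x + r) * conj (h x)) =
      (L : ℂ) ^ 3 * cellFourierCoeff L h p * (cellWave L p x * conj (h x)) := by
    intro x
    have h1 : ∀ r, conj (cellWave L p r) * (h (x + r) * conj (h x)) =
        cellWave L p x * conj (h x) * (conj (cellWave L p (r + x)) * h (r + x)) := by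
      intro r
      rw [conj_cellWave_eq_mul_conj_add L p x r, add_comm x r]
      ring
    have h2 : ∫ r in cell L, conj (cellWave L p (r + x)) * h (r + x) =
        ∫ s in cell L, conj (cellWave L p s) * h s :=
      setIntegral_cell_comp_add_of_periodic hL (H := fun s => conj (cellWave L p s) * h s) hH x
    simp_rw [h1]
    rw [integral_const_mul, h2, integral_conj_cellWave_mul hL h p]
    ring
  have hsq : cellFourierCoeff L h p * conj (cellFourierCoeff L h p) =
      ((‖cellFourierCoeff L h p‖ ^ 2 : ℝ) : ℂ) := by
    rw [Complex.mul_conj, Complex.normSq_eq_norm_sq]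
  calc ∫ r in cell L, conj (cellWave L p r) * ∫ x in cell L, h (x + r) * conj (h x)
      = ∫ r in cell L, ∫ x in cell L, conj (cellWave L p r) * (h (x + r) * conj (h x)) := by
        congr 1; funext r; rw [integral_const_mul]
    _ = ∫ x in cell L, ∫ r in cell L, conj (cellWave L p r) * (h (x + r) * conj (h x)) :=
        integral_integral_swap hF
    _ = ∫ x in cell L, (L : ℂ) ^ 3 * cellFourierCoeff L h p * (cellWave L p x * conj (h x)) := by
        congr 1; funext x; exact hinner x
    _ = (L : ℂ) ^ 3 * cellFourierCoeff L h p * conj (∫ x in cell L, conj (cellWave L p x) * h x) := by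
        rw [integral_const_mul, ← integral_conj]
        congr 1
        refine integral_congr_ae (Eventually.of_forall fun x => ?_)
        simp only [map_mul, Complex.conj_conj]
    _ = (L : ℂ) ^ 3 * (L : ℂ) ^ 3 * (cellFourierCoeff L h p * conj (cellFourierCoeff L h p)) := by
        rw [integral_conj_cellWave_mul hL h p, map_mul, map_pow, Complex.conj_ofReal]
        ring
    _ = (((L ^ 3) ^ 2 * ‖cellFourierCoeff L h p‖ ^ 2 : ℝ) : ℂ) := by
        rw [hsq]
        push_cast
        ring


end LaplacianModeCounting

end Summit.AtomisticToContinuum.BoseEinsteinCondensation.Theorems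

end
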